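import Summits.MatrixMultiplication.MatrixMultiplication.Theorems.ObstructionDescentUniversalOccurrenceKronecker
import Literature.Computability.AlgebraicComplexity.MatMulOccurrenceObstructionsRefutation
import Literature.RepresentationTheory.FiniteGroups.SymmetricGroupCharacterEvaluation

set_option linter.dupNamespace false
set_option autoImplicit false

/-!
# Obstruction descent — the HOOK BAND below the universal-occurrence threshold: `u(N) ≥ 3⌊(N−1)/2⌋ + 1`

Route `ObstructionDescent`, crux `NoOccurrenceObstruction` (`P_O`, stmt-29040), in the matrix-multiplication-free
currency of the companions (`…UniversalOccurrence*`): `UOCC(m,N)` = "every partition triple occurring in a tensor power of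
ANY complex tensor on `≤ N` letters occurs in the same power of the unit tensor `⟨m⟩`" (`K(N,N,N) ⊆ S(⟨m⟩)`,
`uocc_iff_kroneckerSemigroup_le`), `u(N)` = the least such `m`; `P_O ⟸ (∀ n ≥ 2, UOCC(⌈n^{α(n)}⌉, n²))` with
`α(n) → 2` (`noOccurrenceObstruction_of_uocc_threshold`).

## What this file adds (family level)

So far the tree knew `u(N) ≥ N + 1` trivially, `u(n²) ≥ n² + 2` (Bürgisser–Ikenmeyer 2011, Lemma 6.1:
`not_uocc_of_le_sq_add_one`) and the upper bounds `u(N) ≤ ⌈N²/2⌉` (`uocc_of_halfSquare_le`), `u(4) ≤ 7`.  Here: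

* **§1 The hook cube is a UNIVERSAL occurrence obstruction.**  Bürgisser–Ikenmeyer's (2013, §4.4) type
  `λ(κ) = ((κ+1, 1^{2κ}))³ ⊢ 3κ+1` has `2κ+1` rows and its isotypic character sum kills `⟨3κ⟩^{⊗(3κ+1)}`
  (tree: `isotypicSum_bi2013Hook_kroneckerPow_unitTensor_eq_zero`, the obstruction-design half of BI 2013, which
  survives the refutation of the matrix-multiplication half).  Whenever its Kronecker coefficient is positive, `λ(κ)`
  lies in `K(2κ+1) ∖ S(⟨3κ⟩)`, so `¬ UOCC(m, N)` for all `m ≤ 3κ`, `N ≥ 2κ+1` (`not_uocc_of_hookCube`):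
  **`u(N) ≥ 3⌊(N−1)/2⌋ + 1`**, slope `3/2`.
* **§2 Certified Kronecker coefficients.**  `g(λ(κ)) = 1` for `κ = 1, …, 7` by kernel evaluation of the
  Murnaghan–Nakayama class sum (`MNEval.kroneckerCoeff_eq_kronSum_div`, `decide +kernel`; `S_4 … S_22`).  In print
  `g(λ(κ)) = 1` for every `κ` (Remmel 1989 / Rosas 2001, Kronecker products of hook shapes: the hook `(n−c,1^c)` occurs in
  `s_{(n−a,1^a)} ∗ s_{(n−a,1^a)}` with multiplicity one for `c ≤ min(2a, 2n−2−2a)`, here `a = c = 2κ`, `n = 3κ+1`,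
  the boundary case); the general statements below carry that positivity as an explicit hypothesis.
* **§3 Rows.**  Unconditionally for `3 ≤ N ≤ 16`: `3⌊(N−1)/2⌋ + 1 ≤ u(N) ≤ ⌈N²/2⌉` (`uocc_window_of_le_sixteen`);
  cells `¬UOCC(6,5)`, `¬UOCC(9,7)`, `¬UOCC(12,9)`, `¬UOCC(15,11)`, `¬UOCC(18,13)`, `¬UOCC(21,15)`; at the `4 × 4`
  matrix format `N = 16`: `u(16) ≥ 22` (Lemma 6.1 gave `18`).
* **§4 Two naive threshold laws die.**  `u(N) = N + 2` (true at `N = 4` iff the single cell `(6,4)` holds,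
  `…Torsion`) fails at `N = 7` (`u(7) ≥ 10`); more generally no additive law `u(N) ≤ N + c` survives
  (`not_uocc_add_of_le_six` unconditionally for `c ≤ 6`, `exists_not_uocc_add_of_forall_pos` for all `c`).
  The `P_O`-sufficient hypothesis is polynomial (`u(N) ≤ N^{1+o(1)}`), so it is NOT touched by a slope-`3/2` band;
  and the band's mechanism is capped in print: obstruction DESIGNS prove border-rank bounds `≤ 3N − 2`
  (BI 2013, Lemma 4.3/"Lemma 8") and, under the Alon–Kim conjecture, `≤ (3/2 + ε)N` (BI 2013, §4.3) — exactly the slope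
  reached here.
* **§5 Universal ≠ matrix multiplication, concretely.**  At `N = 9 = 3²` the universal obstruction `λ(4)` against
  `⟨12⟩` is invisible to `⟨3,3,3⟩`: `λ(4)` does not occur in `⟨3,3,3⟩^{⊗13}` either (tree refutation of BI 2013
  Lemma 4.4), so it is no witness against the `P_O`-cell `S(⟨3,3,3⟩) ⊆ S(⟨12⟩)` (`hookCube_four_universal_not_matMul`).

Def-free, sorry-free; standard axioms; `decide +kernel` only on closed Murnaghan–Nakayama sums.
-/

open scoped BigOperators

namespace Summit.MatrixMultiplication.MatrixMultiplication.Theorems.ObstructionCalculus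

open Literature.Computability.AlgebraicComplexity (kroneckerPow isotypicSum₁ isotypicSum₂ isotypicSum₃ unitTensor matMulTensor
  exists_occurs_of_kroneckerCoeff_pos bi2013Hook card_parts_bi2013Hook sortedParts_bi2013Hook
  isotypicSum_bi2013Hook_kroneckerPow_unitTensor_eq_zero isotypicSum_bi2013Hook_kroneckerPow_matMulTensor_eq_zero)
open Literature.NumberTheory.DiophantineGeometry (kroneckerCoeff)
open Literature.RepresentationTheory.FiniteGroups.MNEval (kronSum kroneckerCoeff_pos_iff_kronSum_pos
  kroneckerCoeff_eq_kronSum_div)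

/-! ## §1  The hook cube `λ(κ)` as a universal occurrence obstruction -/

/-- **`λ(κ) ∈ K(2κ+1, 2κ+1, 2κ+1)` once its Kronecker coefficient is positive**: the hook `(κ+1, 1^{2κ})` has
`2κ+1` parts (`card_parts_bi2013Hook`), so the triple occurs in the `(3κ+1)`-st tensor power of some complex tensor of
format `2κ+1` (`exists_occurs_of_kroneckerCoeff_pos`). [cite: BurgisserIkenmeyer2011, §3.2, Lemma 3.2] -/
theorem exists_occurs_hookCube_of_kroneckerCoeff_pos (κ : ℕ)
    (hg : 0 < kroneckerCoeff ℂ (bi2013Hook κ) (bi2013Hook κ) (bi2013Hook κ)) :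
    ∃ s : Fin (2 * κ + 1) → Fin (2 * κ + 1) → Fin (2 * κ + 1) → ℂ,
      isotypicSum₁ (bi2013Hook κ) (isotypicSum₂ (bi2013Hook κ) (isotypicSum₃ (bi2013Hook κ)
        (kroneckerPow s (3 * κ + 1)))) ≠ 0 :=
  exists_occurs_of_kroneckerCoeff_pos (lam := fun _ : Fin 3 => bi2013Hook κ)
    (fun _ => (card_parts_bi2013Hook κ).le) hg

/-- **The hook band: `¬ UOCC(m, N)` for `m ≤ 3κ`, `N ≥ 2κ+1`** (given `g(λ(κ)) > 0`, `κ ≥ 1`).  `λ(κ)` occurs for a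
tensor of format `2κ+1 ≤ N` (§1) but its isotypic character sum kills `⟨3κ⟩^{⊗(3κ+1)}`
(`isotypicSum_bi2013Hook_kroneckerPow_unitTensor_eq_zero`), hence kills `⟨m⟩^{⊗(3κ+1)}` for every `m ≤ 3κ`
(`uocc_mono_format`).  So `u(N) ≥ 3κ + 1`. [cite: BurgisserIkenmeyer2013, §4.4 and Prop. 4.2 (Thm. 4.1)] -/
theorem not_uocc_of_hookCube (κ : ℕ) (hκ : 1 ≤ κ)
    (hg : 0 < kroneckerCoeff ℂ (bi2013Hook κ) (bi2013Hook κ) (bi2013Hook κ)) {m N : ℕ}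
    (hm : m ≤ 3 * κ) (hN : 2 * κ + 1 ≤ N) :
    ¬ ∀ {ι : Type} [Fintype ι], Fintype.card ι ≤ N → ∀ (s : ι → ι → ι → ℂ) (d : ℕ)
      (lam : Fin 3 → Nat.Partition d),
      isotypicSum₁ (lam 0) (isotypicSum₂ (lam 1) (isotypicSum₃ (lam 2) (kroneckerPow s d))) ≠ 0 →
      isotypicSum₁ (lam 0) (isotypicSum₂ (lam 1) (isotypicSum₃ (lam 2) (kroneckerPow (unitTensor ℂ m) d))) ≠ 0 := by
  intro hU
  obtain ⟨s, hs⟩ := exists_occurs_hookCube_of_kroneckerCoeff_pos κ hg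
  have h := uocc_mono_format hm hU (ι := Fin (2 * κ + 1)) (by simpa using hN) s (3 * κ + 1)
    (fun _ : Fin 3 => bi2013Hook κ) hs
  exact h (isotypicSum_bi2013Hook_kroneckerPow_unitTensor_eq_zero κ hκ)

/-- **`UOCC(m, N) → 3κ + 1 ≤ m`** for `N ≥ 2κ + 1`, `κ ≥ 1`, `g(λ(κ)) > 0` (contrapositive of `not_uocc_of_hookCube`).
[cite: BurgisserIkenmeyer2013, §4.4 and Prop. 4.2 (Thm. 4.1)] -/
theorem hookBand_le_of_uocc_of_pos {κ m N : ℕ} (hκ : 1 ≤ κ)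
    (hg : 0 < kroneckerCoeff ℂ (bi2013Hook κ) (bi2013Hook κ) (bi2013Hook κ)) (hN : 2 * κ + 1 ≤ N)
    (hU : ∀ {ι : Type} [Fintype ι], Fintype.card ι ≤ N → ∀ (s : ι → ι → ι → ℂ) (d : ℕ)
      (lam : Fin 3 → Nat.Partition d),
      isotypicSum₁ (lam 0) (isotypicSum₂ (lam 1) (isotypicSum₃ (lam 2) (kroneckerPow s d))) ≠ 0 →
      isotypicSum₁ (lam 0) (isotypicSum₂ (lam 1) (isotypicSum₃ (lam 2) (kroneckerPow (unitTensor ℂ m) d))) ≠ 0) :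
    3 * κ + 1 ≤ m := by
  by_contra h
  exact not_uocc_of_hookCube κ hκ hg (by omega) hN hU

/-- **The family statement** (modulo the hook-cube Kronecker positivity `g(λ(κ)) > 0 ∀ κ ≥ 1`, which is `= 1` in print —
Remmel 1989 / Rosas 2001, Kronecker products of two hook shapes, boundary case `c = 2n − 2 − 2a` — and certified below for
`κ ≤ 7`): **`UOCC(m, N) → 3⌊(N−1)/2⌋ + 1 ≤ m` for every `N ≥ 3`**, i.e. `u(N) ≥ (3N−1)/2` (`N` odd), `≥ (3N−4)/2`
(`N` even). [cite: BurgisserIkenmeyer2013, §4.4 and Prop. 4.2 (Thm. 4.1)] -/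
theorem hookBand_le_of_uocc_of_forall_pos
    (hg : ∀ κ : ℕ, 1 ≤ κ → 0 < kroneckerCoeff ℂ (bi2013Hook κ) (bi2013Hook κ) (bi2013Hook κ)) {m N : ℕ}
    (h3 : 3 ≤ N)
    (hU : ∀ {ι : Type} [Fintype ι], Fintype.card ι ≤ N → ∀ (s : ι → ι → ι → ℂ) (d : ℕ)
      (lam : Fin 3 → Nat.Partition d),
      isotypicSum₁ (lam 0) (isotypicSum₂ (lam 1) (isotypicSum₃ (lam 2) (kroneckerPow s d))) ≠ 0 →
      isotypicSum₁ (lam 0) (isotypicSum₂ (lam 1) (isotypicSum₃ (lam 2) (kroneckerPow (unitTensor ℂ m) d))) ≠ 0) :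
    3 * ((N - 1) / 2) + 1 ≤ m :=
  hookBand_le_of_uocc_of_pos (κ := (N - 1) / 2) (by omega) (hg _ (by omega)) (by omega) hU

/-- **No additive threshold law** (modulo hook-cube positivity): for every `c` there is a format `N` (namely `2c + 3`)
with `¬ UOCC(N + c, N)` — the universal threshold is not `N + O(1)`. [cite: BurgisserIkenmeyer2013, §4.4] -/
theorem exists_not_uocc_add_of_forall_pos
    (hg : ∀ κ : ℕ, 1 ≤ κ → 0 < kroneckerCoeff ℂ (bi2013Hook κ) (bi2013Hook κ) (bi2013Hook κ)) (c : ℕ) :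
    ∃ N : ℕ, ¬ ∀ {ι : Type} [Fintype ι], Fintype.card ι ≤ N → ∀ (s : ι → ι → ι → ℂ) (d : ℕ)
      (lam : Fin 3 → Nat.Partition d),
      isotypicSum₁ (lam 0) (isotypicSum₂ (lam 1) (isotypicSum₃ (lam 2) (kroneckerPow s d))) ≠ 0 →
      isotypicSum₁ (lam 0) (isotypicSum₂ (lam 1) (isotypicSum₃ (lam 2) (kroneckerPow (unitTensor ℂ (N + c)) d))) ≠ 0 :=
  ⟨2 * (c + 1) + 1, not_uocc_of_hookCube (c + 1) (by omega) (hg _ (by omega)) (by omega) le_rfl⟩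

/-! ## §2  Certified Kronecker coefficients `g(λ(κ)) = 1`, `κ ≤ 7` (Murnaghan–Nakayama class sums, kernel-decided) -/

/-- **`g(λ(κ)) = 1` from the class sum**: if `Σ_C |C| χ^{hook}(C)³ = (3κ+1)!` then `g(λ(κ)) = 1`
(`kroneckerCoeff_eq_kronSum_div`, `sortedParts_bi2013Hook`). [cite: FultonHarrisGTM129, Exercise 4.51] -/
theorem kroneckerCoeff_hookCube_eq_one_of_kronSum (κ : ℕ)
    (h : kronSum (3 * κ + 1) ((κ + 1) :: List.replicate (2 * κ) 1) ((κ + 1) :: List.replicate (2 * κ) 1)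
      ((κ + 1) :: List.replicate (2 * κ) 1) = ((3 * κ + 1).factorial : ℕ)) :
    kroneckerCoeff ℂ (bi2013Hook κ) (bi2013Hook κ) (bi2013Hook κ) = 1 := by
  have e := kroneckerCoeff_eq_kronSum_div (bi2013Hook κ) (bi2013Hook κ) (bi2013Hook κ)
  rw [sortedParts_bi2013Hook, h, Int.ediv_self (by exact_mod_cast Nat.factorial_ne_zero _)] at e
  exact_mod_cast e

set_option maxHeartbeats 100000000 in
set_option maxRecDepth 100000 in
/-- `g(λ(1)) = g((2,1,1)³) = 1` (`S_4`). [cite: FultonHarrisGTM129, Exercise 4.51] -/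
theorem kroneckerCoeff_hookCube_one : kroneckerCoeff ℂ (bi2013Hook 1) (bi2013Hook 1) (bi2013Hook 1) = 1 :=
  kroneckerCoeff_hookCube_eq_one_of_kronSum 1 (by decide +kernel)

set_option maxHeartbeats 100000000 in
set_option maxRecDepth 100000 in
/-- `g(λ(2)) = g((3,1⁴)³) = 1` (`S_7`). [cite: FultonHarrisGTM129, Exercise 4.51] -/
theorem kroneckerCoeff_hookCube_two : kroneckerCoeff ℂ (bi2013Hook 2) (bi2013Hook 2) (bi2013Hook 2) = 1 :=
  kroneckerCoeff_hookCube_eq_one_of_kronSum 2 (by decide +kernel)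

set_option maxHeartbeats 100000000 in
set_option maxRecDepth 100000 in
/-- `g(λ(3)) = g((4,1⁶)³) = 1` (`S_10`). [cite: FultonHarrisGTM129, Exercise 4.51] -/
theorem kroneckerCoeff_hookCube_three : kroneckerCoeff ℂ (bi2013Hook 3) (bi2013Hook 3) (bi2013Hook 3) = 1 :=
  kroneckerCoeff_hookCube_eq_one_of_kronSum 3 (by decide +kernel)

set_option maxHeartbeats 100000000 in
set_option maxRecDepth 100000 in
/-- `g(λ(4)) = g((5,1⁸)³) = 1` (`S_13`). [cite: FultonHarrisGTM129, Exercise 4.51] -/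
theorem kroneckerCoeff_hookCube_four : kroneckerCoeff ℂ (bi2013Hook 4) (bi2013Hook 4) (bi2013Hook 4) = 1 :=
  kroneckerCoeff_hookCube_eq_one_of_kronSum 4 (by decide +kernel)

set_option maxHeartbeats 100000000 in
set_option maxRecDepth 100000 in
/-- `g(λ(5)) = g((6,1¹⁰)³) = 1` (`S_16`). [cite: FultonHarrisGTM129, Exercise 4.51] -/
theorem kroneckerCoeff_hookCube_five : kroneckerCoeff ℂ (bi2013Hook 5) (bi2013Hook 5) (bi2013Hook 5) = 1 :=
  kroneckerCoeff_hookCube_eq_one_of_kronSum 5 (by decide +kernel)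

set_option maxHeartbeats 100000000 in
set_option maxRecDepth 100000 in
/-- `g(λ(6)) = g((7,1¹²)³) = 1` (`S_19`). [cite: FultonHarrisGTM129, Exercise 4.51] -/
theorem kroneckerCoeff_hookCube_six : kroneckerCoeff ℂ (bi2013Hook 6) (bi2013Hook 6) (bi2013Hook 6) = 1 :=
  kroneckerCoeff_hookCube_eq_one_of_kronSum 6 (by decide +kernel)

set_option maxHeartbeats 100000000 in
set_option maxRecDepth 100000 in
/-- `g(λ(7)) = g((8,1¹⁴)³) = 1` (`S_22`). [cite: FultonHarrisGTM129, Exercise 4.51] -/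
theorem kroneckerCoeff_hookCube_seven : kroneckerCoeff ℂ (bi2013Hook 7) (bi2013Hook 7) (bi2013Hook 7) = 1 :=
  kroneckerCoeff_hookCube_eq_one_of_kronSum 7 (by decide +kernel)

/-- **`g(λ(κ)) = 1` for `1 ≤ κ ≤ 7`.** [cite: FultonHarrisGTM129, Exercise 4.51] -/
theorem kroneckerCoeff_hookCube_eq_one_of_le_seven {κ : ℕ} (h1 : 1 ≤ κ) (h7 : κ ≤ 7) :
    kroneckerCoeff ℂ (bi2013Hook κ) (bi2013Hook κ) (bi2013Hook κ) = 1 := by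
  interval_cases κ
  exacts [kroneckerCoeff_hookCube_one, kroneckerCoeff_hookCube_two, kroneckerCoeff_hookCube_three,
    kroneckerCoeff_hookCube_four, kroneckerCoeff_hookCube_five, kroneckerCoeff_hookCube_six,
    kroneckerCoeff_hookCube_seven]

/-- **`g(λ(κ)) > 0` for `1 ≤ κ ≤ 7`.** [cite: FultonHarrisGTM129, Exercise 4.51] -/
theorem kroneckerCoeff_hookCube_pos_of_le_seven {κ : ℕ} (h1 : 1 ≤ κ) (h7 : κ ≤ 7) :
    0 < kroneckerCoeff ℂ (bi2013Hook κ) (bi2013Hook κ) (bi2013Hook κ) := by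
  rw [kroneckerCoeff_hookCube_eq_one_of_le_seven h1 h7]
  exact Nat.one_pos

/-! ## §3  Rows `3 ≤ N ≤ 16`: the unconditional band and the windows -/

/-- **Unconditional hook band, `κ ≤ 7`**: `UOCC(m, N) → 3κ + 1 ≤ m` for `1 ≤ κ ≤ 7`, `N ≥ 2κ + 1`.
[cite: BurgisserIkenmeyer2013, §4.4 and Prop. 4.2 (Thm. 4.1)] -/
theorem hookBand_le_of_uocc {κ m N : ℕ} (hκ : 1 ≤ κ) (hκ7 : κ ≤ 7) (hN : 2 * κ + 1 ≤ N)
    (hU : ∀ {ι : Type} [Fintype ι], Fintype.card ι ≤ N → ∀ (s : ι → ι → ι → ℂ) (d : ℕ)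
      (lam : Fin 3 → Nat.Partition d),
      isotypicSum₁ (lam 0) (isotypicSum₂ (lam 1) (isotypicSum₃ (lam 2) (kroneckerPow s d))) ≠ 0 →
      isotypicSum₁ (lam 0) (isotypicSum₂ (lam 1) (isotypicSum₃ (lam 2) (kroneckerPow (unitTensor ℂ m) d))) ≠ 0) :
    3 * κ + 1 ≤ m :=
  hookBand_le_of_uocc_of_pos hκ (kroneckerCoeff_hookCube_pos_of_le_seven hκ hκ7) hN hU

/-- **`u(N) ≥ 3⌊(N−1)/2⌋ + 1` for `3 ≤ N ≤ 16`, unconditionally**: `u(3) ≥ 4`, `u(5) ≥ 7`, `u(7) ≥ 10`, `u(9) ≥ 13`,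
`u(11) ≥ 16`, `u(13) ≥ 19`, `u(15) ≥ 22` (and the even rows inherit the odd row below).
[cite: BurgisserIkenmeyer2013, §4.4 and Prop. 4.2 (Thm. 4.1)] -/
theorem hookBand_le_of_uocc_of_le_sixteen {m N : ℕ} (h3 : 3 ≤ N) (h16 : N ≤ 16)
    (hU : ∀ {ι : Type} [Fintype ι], Fintype.card ι ≤ N → ∀ (s : ι → ι → ι → ℂ) (d : ℕ)
      (lam : Fin 3 → Nat.Partition d),
      isotypicSum₁ (lam 0) (isotypicSum₂ (lam 1) (isotypicSum₃ (lam 2) (kroneckerPow s d))) ≠ 0 →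
      isotypicSum₁ (lam 0) (isotypicSum₂ (lam 1) (isotypicSum₃ (lam 2) (kroneckerPow (unitTensor ℂ m) d))) ≠ 0) :
    3 * ((N - 1) / 2) + 1 ≤ m :=
  hookBand_le_of_uocc (κ := (N - 1) / 2) (by omega) (by omega) (by omega) hU

/-- **The window `3⌊(N−1)/2⌋ + 1 ≤ u(N) ≤ ⌈N²/2⌉` for `3 ≤ N ≤ 16`**: the cell just below the band fails
(`not_uocc_of_hookCube`) and the half-square cell holds (`uocc_of_halfSquare_le`).  Rows: `N=5: [7,13]`, `N=7: [10,25]`,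
`N=9: [13,41]`, `N=11: [16,61]`, `N=13: [19,85]`, `N=15: [22,113]`, `N=16: [22,128]`.
[cite: BurgisserIkenmeyer2013, §4.4; BurgisserIkenmeyer2011, §3.2] -/
theorem uocc_window_of_le_sixteen (N : ℕ) (h3 : 3 ≤ N) (h16 : N ≤ 16) :
    (¬ ∀ {ι : Type} [Fintype ι], Fintype.card ι ≤ N → ∀ (s : ι → ι → ι → ℂ) (d : ℕ)
      (lam : Fin 3 → Nat.Partition d),
      isotypicSum₁ (lam 0) (isotypicSum₂ (lam 1) (isotypicSum₃ (lam 2) (kroneckerPow s d))) ≠ 0 →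
      isotypicSum₁ (lam 0) (isotypicSum₂ (lam 1) (isotypicSum₃ (lam 2)
        (kroneckerPow (unitTensor ℂ (3 * ((N - 1) / 2))) d))) ≠ 0) ∧
    (∀ {ι : Type} [Fintype ι], Fintype.card ι ≤ N → ∀ (s : ι → ι → ι → ℂ) (d : ℕ)
      (lam : Fin 3 → Nat.Partition d),
      isotypicSum₁ (lam 0) (isotypicSum₂ (lam 1) (isotypicSum₃ (lam 2) (kroneckerPow s d))) ≠ 0 →
      isotypicSum₁ (lam 0) (isotypicSum₂ (lam 1) (isotypicSum₃ (lam 2)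
        (kroneckerPow (unitTensor ℂ (((N + 1) / 2) ^ 2 + (N / 2) ^ 2)) d))) ≠ 0) :=
  ⟨not_uocc_of_hookCube ((N - 1) / 2) (by omega)
      (kroneckerCoeff_hookCube_pos_of_le_seven (by omega) (by omega)) le_rfl (by omega),
    uocc_of_halfSquare_le (by omega) le_rfl⟩

/-- **Cell `(6, 5)` fails: `u(5) ≥ 7`** (`κ = 2`; with `uocc_thirteen_five`: `7 ≤ u(5) ≤ 13`).
[cite: BurgisserIkenmeyer2013, §4.4] -/
theorem not_uocc_six_five :
    ¬ ∀ {ι : Type} [Fintype ι], Fintype.card ι ≤ 5 → ∀ (s : ι → ι → ι → ℂ) (d : ℕ)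
      (lam : Fin 3 → Nat.Partition d),
      isotypicSum₁ (lam 0) (isotypicSum₂ (lam 1) (isotypicSum₃ (lam 2) (kroneckerPow s d))) ≠ 0 →
      isotypicSum₁ (lam 0) (isotypicSum₂ (lam 1) (isotypicSum₃ (lam 2) (kroneckerPow (unitTensor ℂ 6) d))) ≠ 0 :=
  not_uocc_of_hookCube 2 (by norm_num) (kroneckerCoeff_hookCube_pos_of_le_seven (by norm_num) (by norm_num))
    le_rfl le_rfl

/-- **Cell `(9, 7)` fails: `u(7) ≥ 10`** (`κ = 3`) — this kills the law "`u(N) = N + 2`". [cite: BurgisserIkenmeyer2013, §4.4] -/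
theorem not_uocc_nine_seven :
    ¬ ∀ {ι : Type} [Fintype ι], Fintype.card ι ≤ 7 → ∀ (s : ι → ι → ι → ℂ) (d : ℕ)
      (lam : Fin 3 → Nat.Partition d),
      isotypicSum₁ (lam 0) (isotypicSum₂ (lam 1) (isotypicSum₃ (lam 2) (kroneckerPow s d))) ≠ 0 →
      isotypicSum₁ (lam 0) (isotypicSum₂ (lam 1) (isotypicSum₃ (lam 2) (kroneckerPow (unitTensor ℂ 9) d))) ≠ 0 :=
  not_uocc_of_hookCube 3 (by norm_num) (kroneckerCoeff_hookCube_pos_of_le_seven (by norm_num) (by norm_num))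
    le_rfl le_rfl

/-- **Cell `(12, 9)` fails: `u(9) ≥ 13`** (`κ = 4`; the `3 × 3` matrix format; upper bound `41`, `uocc_of_halfSquare_le`).
[cite: BurgisserIkenmeyer2013, §4.4] -/
theorem not_uocc_twelve_nine :
    ¬ ∀ {ι : Type} [Fintype ι], Fintype.card ι ≤ 9 → ∀ (s : ι → ι → ι → ℂ) (d : ℕ)
      (lam : Fin 3 → Nat.Partition d),
      isotypicSum₁ (lam 0) (isotypicSum₂ (lam 1) (isotypicSum₃ (lam 2) (kroneckerPow s d))) ≠ 0 →
      isotypicSum₁ (lam 0) (isotypicSum₂ (lam 1) (isotypicSum₃ (lam 2) (kroneckerPow (unitTensor ℂ 12) d))) ≠ 0 :=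
  not_uocc_of_hookCube 4 (by norm_num) (kroneckerCoeff_hookCube_pos_of_le_seven (by norm_num) (by norm_num))
    le_rfl le_rfl

/-- **Cell `(15, 11)` fails: `u(11) ≥ 16`** (`κ = 5`). [cite: BurgisserIkenmeyer2013, §4.4] -/
theorem not_uocc_fifteen_eleven :
    ¬ ∀ {ι : Type} [Fintype ι], Fintype.card ι ≤ 11 → ∀ (s : ι → ι → ι → ℂ) (d : ℕ)
      (lam : Fin 3 → Nat.Partition d),
      isotypicSum₁ (lam 0) (isotypicSum₂ (lam 1) (isotypicSum₃ (lam 2) (kroneckerPow s d))) ≠ 0 →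
      isotypicSum₁ (lam 0) (isotypicSum₂ (lam 1) (isotypicSum₃ (lam 2) (kroneckerPow (unitTensor ℂ 15) d))) ≠ 0 :=
  not_uocc_of_hookCube 5 (by norm_num) (kroneckerCoeff_hookCube_pos_of_le_seven (by norm_num) (by norm_num))
    le_rfl le_rfl

/-- **Cell `(18, 13)` fails: `u(13) ≥ 19`** (`κ = 6`). [cite: BurgisserIkenmeyer2013, §4.4] -/
theorem not_uocc_eighteen_thirteen :
    ¬ ∀ {ι : Type} [Fintype ι], Fintype.card ι ≤ 13 → ∀ (s : ι → ι → ι → ℂ) (d : ℕ)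
      (lam : Fin 3 → Nat.Partition d),
      isotypicSum₁ (lam 0) (isotypicSum₂ (lam 1) (isotypicSum₃ (lam 2) (kroneckerPow s d))) ≠ 0 →
      isotypicSum₁ (lam 0) (isotypicSum₂ (lam 1) (isotypicSum₃ (lam 2) (kroneckerPow (unitTensor ℂ 18) d))) ≠ 0 :=
  not_uocc_of_hookCube 6 (by norm_num) (kroneckerCoeff_hookCube_pos_of_le_seven (by norm_num) (by norm_num))
    le_rfl le_rfl

/-- **Cell `(21, 15)` fails: `u(15) ≥ 22`** (`κ = 7`). [cite: BurgisserIkenmeyer2013, §4.4] -/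
theorem not_uocc_twentyone_fifteen :
    ¬ ∀ {ι : Type} [Fintype ι], Fintype.card ι ≤ 15 → ∀ (s : ι → ι → ι → ℂ) (d : ℕ)
      (lam : Fin 3 → Nat.Partition d),
      isotypicSum₁ (lam 0) (isotypicSum₂ (lam 1) (isotypicSum₃ (lam 2) (kroneckerPow s d))) ≠ 0 →
      isotypicSum₁ (lam 0) (isotypicSum₂ (lam 1) (isotypicSum₃ (lam 2) (kroneckerPow (unitTensor ℂ 21) d))) ≠ 0 :=
  not_uocc_of_hookCube 7 (by norm_num) (kroneckerCoeff_hookCube_pos_of_le_seven (by norm_num) (by norm_num))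
    le_rfl le_rfl

/-- **The `4 × 4` matrix format `N = 16`: `u(16) ≥ 22`** (`κ = 7`, `2κ+1 = 15 ≤ 16`), past the `n² + 2 = 18` of
Bürgisser–Ikenmeyer 2011 Lemma 6.1 (`not_uocc_of_le_sq_add_one 4`). [cite: BurgisserIkenmeyer2013, §4.4; BurgisserIkenmeyer2011, Lemma 6.1] -/
theorem twentytwo_le_of_uocc_sixteen {m : ℕ}
    (hU : ∀ {ι : Type} [Fintype ι], Fintype.card ι ≤ 16 → ∀ (s : ι → ι → ι → ℂ) (d : ℕ)
      (lam : Fin 3 → Nat.Partition d),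
      isotypicSum₁ (lam 0) (isotypicSum₂ (lam 1) (isotypicSum₃ (lam 2) (kroneckerPow s d))) ≠ 0 →
      isotypicSum₁ (lam 0) (isotypicSum₂ (lam 1) (isotypicSum₃ (lam 2) (kroneckerPow (unitTensor ℂ m) d))) ≠ 0) :
    22 ≤ m :=
  hookBand_le_of_uocc (κ := 7) (by norm_num) le_rfl (by norm_num) hU

/-- **The `3 × 3` matrix format `N = 9`: `13 ≤ u(9)`**, against `u(9) ≥ 11` from Lemma 6.1 (`not_uocc_of_le_sq_add_one 3`)
and the in-tree upper bound `u(9) ≤ 41`. [cite: BurgisserIkenmeyer2013, §4.4] -/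
theorem thirteen_le_of_uocc_nine {m : ℕ}
    (hU : ∀ {ι : Type} [Fintype ι], Fintype.card ι ≤ 9 → ∀ (s : ι → ι → ι → ℂ) (d : ℕ)
      (lam : Fin 3 → Nat.Partition d),
      isotypicSum₁ (lam 0) (isotypicSum₂ (lam 1) (isotypicSum₃ (lam 2) (kroneckerPow s d))) ≠ 0 →
      isotypicSum₁ (lam 0) (isotypicSum₂ (lam 1) (isotypicSum₃ (lam 2) (kroneckerPow (unitTensor ℂ m) d))) ≠ 0) :
    13 ≤ m :=
  hookBand_le_of_uocc (κ := 4) (by norm_num) (by norm_num) (by norm_num) hU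

/-- **`7 ≤ u(5)`.** [cite: BurgisserIkenmeyer2013, §4.4] -/
theorem seven_le_of_uocc_five {m : ℕ}
    (hU : ∀ {ι : Type} [Fintype ι], Fintype.card ι ≤ 5 → ∀ (s : ι → ι → ι → ℂ) (d : ℕ)
      (lam : Fin 3 → Nat.Partition d),
      isotypicSum₁ (lam 0) (isotypicSum₂ (lam 1) (isotypicSum₃ (lam 2) (kroneckerPow s d))) ≠ 0 →
      isotypicSum₁ (lam 0) (isotypicSum₂ (lam 1) (isotypicSum₃ (lam 2) (kroneckerPow (unitTensor ℂ m) d))) ≠ 0) :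
    7 ≤ m :=
  hookBand_le_of_uocc (κ := 2) (by norm_num) (by norm_num) (by norm_num) hU

/-- **`10 ≤ u(7)`.** [cite: BurgisserIkenmeyer2013, §4.4] -/
theorem ten_le_of_uocc_seven {m : ℕ}
    (hU : ∀ {ι : Type} [Fintype ι], Fintype.card ι ≤ 7 → ∀ (s : ι → ι → ι → ℂ) (d : ℕ)
      (lam : Fin 3 → Nat.Partition d),
      isotypicSum₁ (lam 0) (isotypicSum₂ (lam 1) (isotypicSum₃ (lam 2) (kroneckerPow s d))) ≠ 0 →
      isotypicSum₁ (lam 0) (isotypicSum₂ (lam 1) (isotypicSum₃ (lam 2) (kroneckerPow (unitTensor ℂ m) d))) ≠ 0) :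
    10 ≤ m :=
  hookBand_le_of_uocc (κ := 3) (by norm_num) (by norm_num) (by norm_num) hU

/-! ## §4  Two naive threshold laws die -/

/-- **"`u(N) = N + 2`" is false as a law**: `UOCC(N + 2, N)` fails at `N = 7` (`u(7) ≥ 10`).  (At `N = 4` the law is the
single open cell `(6,4)`, `uocc_six_four_iff_utor`.) [cite: BurgisserIkenmeyer2013, §4.4] -/
theorem not_forall_uocc_add_two :
    ¬ ∀ N : ℕ, 3 ≤ N → ∀ {ι : Type} [Fintype ι], Fintype.card ι ≤ N → ∀ (s : ι → ι → ι → ℂ) (d : ℕ)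
      (lam : Fin 3 → Nat.Partition d),
      isotypicSum₁ (lam 0) (isotypicSum₂ (lam 1) (isotypicSum₃ (lam 2) (kroneckerPow s d))) ≠ 0 →
      isotypicSum₁ (lam 0) (isotypicSum₂ (lam 1) (isotypicSum₃ (lam 2) (kroneckerPow (unitTensor ℂ (N + 2)) d))) ≠ 0 :=
  fun h => not_uocc_nine_seven (h 7 (by norm_num))

/-- **No additive law `u(N) ≤ N + c` for `c ≤ 6`, unconditionally**: `¬ UOCC((2c+3) + c, 2c+3)` (`κ = c + 1 ≤ 7`).
[cite: BurgisserIkenmeyer2013, §4.4] -/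
theorem not_uocc_add_of_le_six (c : ℕ) (hc : c ≤ 6) :
    ¬ ∀ {ι : Type} [Fintype ι], Fintype.card ι ≤ 2 * c + 3 → ∀ (s : ι → ι → ι → ℂ) (d : ℕ)
      (lam : Fin 3 → Nat.Partition d),
      isotypicSum₁ (lam 0) (isotypicSum₂ (lam 1) (isotypicSum₃ (lam 2) (kroneckerPow s d))) ≠ 0 →
      isotypicSum₁ (lam 0) (isotypicSum₂ (lam 1) (isotypicSum₃ (lam 2)
        (kroneckerPow (unitTensor ℂ (2 * c + 3 + c)) d))) ≠ 0 :=
  not_uocc_of_hookCube (c + 1) (by omega) (kroneckerCoeff_hookCube_pos_of_le_seven (by omega) (by omega))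
    (by omega) (by omega)

/-! ## §5  Universal ≠ matrix multiplication at the `3 × 3` format -/

/-- **The universal obstruction at `(12, 9)` is invisible to `⟨3,3,3⟩`.**  `λ(4) = ((5,1⁸))³ ⊢ 13` occurs for some
tensor of format `9` (§1, §2), does not occur in `⟨12⟩^{⊗13}` (BI 2013 obstruction-design half), and does NOT occur in
`⟨3,3,3⟩^{⊗13}` either (tree refutation of BI 2013 Lemma 4.4, `isotypicSum_bi2013Hook_kroneckerPow_matMulTensor_eq_zero`):
so `λ(4)` witnesses `¬ UOCC(12, 9)` but is no witness against the `P_O`-cell `S(⟨3,3,3⟩) ⊆ S(⟨12⟩)` — universal occurrence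
is a strictly stronger demand than the route's crux at this cell. [cite: BurgisserIkenmeyer2013, §4.4, Lemma 4.4 (refuted as printed) and Prop. 4.2] -/
theorem hookCube_four_universal_not_matMul :
    (∃ s : Fin 9 → Fin 9 → Fin 9 → ℂ,
      isotypicSum₁ (bi2013Hook 4) (isotypicSum₂ (bi2013Hook 4) (isotypicSum₃ (bi2013Hook 4) (kroneckerPow s 13))) ≠ 0) ∧
    isotypicSum₁ (bi2013Hook 4) (isotypicSum₂ (bi2013Hook 4) (isotypicSum₃ (bi2013Hook 4)
      (kroneckerPow (unitTensor ℂ 12) 13))) = 0 ∧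
    isotypicSum₁ (bi2013Hook 4) (isotypicSum₂ (bi2013Hook 4) (isotypicSum₃ (bi2013Hook 4)
      (kroneckerPow (matMulTensor ℂ 3 3 3) 13))) = 0 :=
  ⟨exists_occurs_hookCube_of_kroneckerCoeff_pos 4 (kroneckerCoeff_hookCube_pos_of_le_seven (by norm_num) (by norm_num)),
    isotypicSum_bi2013Hook_kroneckerPow_unitTensor_eq_zero 4 (by norm_num),
    isotypicSum_bi2013Hook_kroneckerPow_matMulTensor_eq_zero 3 4 le_rfl (by norm_num)⟩

end Summit.MatrixMultiplication.MatrixMultiplication.Theorems.ObstructionCalculus
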